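import Mathlib.Analysis.SpecialFunctions.Pow.Real
import Mathlib.Analysis.SpecialFunctions.Log.Basic
import Mathlib.Analysis.Complex.ExponentialBounds
import HarnessLib

/-!
# The Mahler–Manin theorem, fifth step: the choice of parameters (real-analysis bookkeeping)

Everything in this file is **proved**; there are no new definitions.  This is the purely
real-analytic last step of the `p`-adic proof of the Mahler–Manin conjecture after
Barré-Sirieix–Diaz–Gramain–Philibert (1996) (Nesterenko–Philippon LNM 1752, Ch. 2, §2.5, "last
step": the constraints are compatible for `L₁, L₂ ≍ √N`).  With the parameters

  `L₁ = 2T⁶`, `L₂ = T⁴`, `N = T¹⁰`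

of `MahlerManinSiegelStep.lean`, the four estimates produced by the previous steps for the order of
vanishing `M ≥ N`, the length `L(a)` of the auxiliary polynomial, its `M`-th coefficient `b_M`, the
least non-vanishing prime `S` and the sum `Σ_{ℓ<S prime} ℓ` —

* Siegel: `1 ≤ L(a) ≤ 4T²⁰ e^{56T⁷ + 27T⁴}`, `1 ≤ |b_M| ≤ L(a) e^{56 T² √M + 27 T⁴}`;
* zero estimate: `(Σ_{ℓ<S prime} ℓ) · λ ≤ log |b_M|` (`λ = log(1/‖q‖_p) > 0`), and Chebyshev
  `Σ_{ℓ<S prime} ℓ ≥ S²/(32 log² S)` for `S ≥ 16`;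
* Liouville vs. Schwarz: `S M λ ≤ d₀ (S+1) [log L(a) + S (L₁ + L₂) c_q + L₂ (log⁺ L(Φ_S) + (S+1) c_J)]`
  with `L(Φ_S) ≤ (S+2)² e^{c_Φ S √S}` —

force `T ≤ T₀(λ, d₀, c_q, c_J, c_Φ)` (`mahlerManin_parameter_bound`).  The proof substitutes
`M = u¹⁰⁰`: then `T ≤ u¹⁰`, `log|b_M| ≪ u⁷⁰`, `S ≪ u³⁶`, and the main inequality reads
`λ u¹⁰⁰ ≪ u⁹⁶`.

## References

* [NesterenkoPhilippon2001] LNM 1752, Ch. 2 (G. Diaz), §2.5, last step (constraints (C1)–(C4)).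
* [BarreSirieixDiazGramainPhilibert1996Manin] Invent. Math. 124 (1996) 1–9, §5.
-/

noncomputable section

open Real

namespace Literature.NumberTheory.Transcendental

/-- `log x ≤ x` for `0 < x` (indeed `log x ≤ x - 1`). [folklore] -/
theorem log_le_self_of_pos {x : ℝ} (hx : 0 < x) : Real.log x ≤ x := by
  have := Real.log_le_sub_one_of_pos hx; linarith

/-- `(log x)² ≤ 4 x` for `1 ≤ x` (from `log x = 2 log √x ≤ 2 √x`). [folklore] -/
theorem log_sq_le_four_mul {x : ℝ} (hx : 1 ≤ x) : Real.log x ^ 2 ≤ 4 * x := by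
  have hx0 : 0 < x := by linarith
  have hs := Real.sqrt_pos.mpr hx0
  have h1 : Real.log x = 2 * Real.log (Real.sqrt x) := by
    rw [Real.log_sqrt hx0.le]; ring
  have h2 : Real.log (Real.sqrt x) ≤ Real.sqrt x - 1 := Real.log_le_sub_one_of_pos hs
  have h3 : 0 ≤ Real.log x := Real.log_nonneg hx
  have h4 : Real.log x ≤ 2 * Real.sqrt x := by rw [h1]; linarith
  calc Real.log x ^ 2 ≤ (2 * Real.sqrt x) ^ 2 := pow_le_pow_left₀ h3 h4 2
    _ = 4 * x := by rw [mul_pow, Real.sq_sqrt hx0.le]; ring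

/-- **The parameters cannot all be large** (Nesterenko–Philippon Ch. 2 §2.5, last step).  Given
`λ > 0`, `d₀, c_q, c_J, c_Φ ≥ 0` there is `T₀` such that: whenever real numbers
`T ≥ 1`, `M ≥ T¹⁰`, `S ≥ 2`, `L_a, B, P, L_Φ` satisfy the estimates of the first four steps
(Siegel bounds for `L_a` and `B = |b_M|`, the zero estimate `P λ ≤ log B` with Chebyshev's
`S²/(32 log² S) ≤ P` for `S ≥ 16`, the bound `L_Φ ≤ (S+2)² e^{c_Φ S √S}`, and the main
inequality `S M λ ≤ d₀ (S+1)(log L_a + S(2T⁶ + T⁴) c_q + T⁴(log⁺ L_Φ + (S+1) c_J))`), then `T ≤ T₀`.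
[cite: NesterenkoPhilippon2001, Ch. 2, §2.5] -/
theorem mahlerManin_parameter_bound {lam d₀ cq cJ cΦ : ℝ} (hlam : 0 < lam) (hd₀ : 0 ≤ d₀)
    (hcq : 0 ≤ cq) (hcJ : 0 ≤ cJ) (hcΦ : 0 ≤ cΦ) :
    ∃ T₀ : ℝ, ∀ (T M S La B P LΦ : ℝ), 1 ≤ T → T ^ 10 ≤ M → 2 ≤ S →
      1 ≤ La → La ≤ 4 * T ^ 20 * Real.exp (56 * T ^ 7 + 27 * T ^ 4) →
      1 ≤ B → B ≤ La * Real.exp (56 * T ^ 2 * Real.sqrt M + 27 * T ^ 4) →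
      P * lam ≤ Real.log B → (16 ≤ S → S ^ 2 / (32 * Real.log S ^ 2) ≤ P) →
      0 ≤ LΦ → LΦ ≤ (S + 2) ^ 2 * Real.exp (cΦ * S * Real.sqrt S) →
      S * M * lam ≤ d₀ * (S + 1) * (Real.log La + S * (2 * T ^ 6 + T ^ 4) * cq +
        T ^ 4 * (Real.log (max 1 LΦ) + (S + 1) * cJ)) →
      T ≤ T₀ := by
  -- the constants (introduced as opaque reals with their defining equations)
  obtain ⟨C₀, hC₀⟩ : ∃ C₀ : ℝ, C₀ = Real.log (max 1 (128 * 188 / lam)) := ⟨_, rfl⟩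
  have hC₀0 : 0 ≤ C₀ := by rw [hC₀]; exact Real.log_nonneg (le_max_left _ _)
  obtain ⟨CS, hCS⟩ : ∃ CS : ℝ, CS = max 16 (Real.sqrt (32 * 188 / lam) * (C₀ + 70)) := ⟨_, rfl⟩
  have hCS16 : 16 ≤ CS := by rw [hCS]; exact le_max_left _ _
  have hCS0 : 0 ≤ CS := le_trans (by norm_num) hCS16
  have hCS1 : 1 ≤ CS := le_trans (by norm_num) hCS16
  obtain ⟨Ctot, hCtot⟩ : ∃ Ctot : ℝ,
      Ctot = 105 + 3 * cq * CS + 4 * CS + cΦ * CS * Real.sqrt CS + 2 * cJ * CS := ⟨_, rfl⟩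
  have hCtot0 : 0 ≤ Ctot := by rw [hCtot]; positivity
  obtain ⟨Cfin, hCfin⟩ : ∃ Cfin : ℝ, Cfin = max 1 (2 * d₀ * Ctot / lam) := ⟨_, rfl⟩
  have hCfin1 : 1 ≤ Cfin := by rw [hCfin]; exact le_max_left _ _
  refine ⟨Cfin ^ 3, ?_⟩
  intro T M S La B P LΦ hT hTM hS hLa1 hLa hB1 hB hZE hCheb hLΦ0 hLΦ hMain
  -- `u = M^{1/100}`
  have hM1 : 1 ≤ M := le_trans (one_le_pow₀ hT) hTM
  have hM0 : 0 ≤ M := by linarith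
  obtain ⟨u, hu100, hu1⟩ : ∃ u : ℝ, u ^ 100 = M ∧ 1 ≤ u :=
    ⟨M ^ ((100 : ℕ) : ℝ)⁻¹, Real.rpow_inv_natCast_pow hM0 (by norm_num),
      Real.one_le_rpow hM1 (by positivity)⟩
  have hu0 : 0 ≤ u := by linarith
  have hupow : ∀ {m n : ℕ}, m ≤ n → u ^ m ≤ u ^ n := fun h ↦ pow_le_pow_right₀ hu1 h
  -- `T ≤ u^10`, `√M = u^50`, `log M ≤ 100 u`
  have hTu : T ≤ u ^ 10 := by
    have h : T ^ 10 ≤ (u ^ 10) ^ 10 := by rw [← pow_mul]; norm_num; rw [hu100]; exact hTM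
    exact (pow_le_pow_iff_left₀ (by linarith) (by positivity) (by norm_num)).mp h
  have hT0 : 0 ≤ T := by linarith
  have hTpow : ∀ n : ℕ, T ^ n ≤ u ^ (10 * n) := fun n ↦ by
    rw [pow_mul]; exact pow_le_pow_left₀ hT0 hTu n
  have hsqrtM : Real.sqrt M = u ^ 50 := by
    rw [← hu100, show u ^ 100 = (u ^ 50) ^ 2 by ring, Real.sqrt_sq (by positivity)]
  -- (Q1) `log La ≤ 105 u^70`
  have hlog4 : Real.log 4 ≤ 2 := by
    rw [show (4 : ℝ) = 2 ^ 2 by norm_num, Real.log_pow]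
    have := Real.log_two_lt_d9
    norm_num at this ⊢
    linarith
  have hlogT : Real.log T ≤ T := log_le_self_of_pos (by linarith)
  have hT7 : ∀ {n : ℕ}, n ≤ 7 → T ^ n ≤ T ^ 7 := fun h ↦ pow_le_pow_right₀ hT h
  have hLaLog : Real.log La ≤ 105 * u ^ 70 := by
    have h1 : Real.log La ≤ Real.log 4 + 20 * Real.log T + (56 * T ^ 7 + 27 * T ^ 4) := by
      have := Real.log_le_log (by linarith) hLa
      rw [Real.log_mul (by positivity) (by positivity), Real.log_mul (by positivity) (by positivity),
        Real.log_exp, Real.log_pow] at this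
      push_cast at this
      linarith
    have h2 : Real.log La ≤ 105 * T ^ 7 := by
      have t1 : T ≤ T ^ 7 := by simpa using hT7 (show 1 ≤ 7 by norm_num)
      have t4 : T ^ 4 ≤ T ^ 7 := hT7 (show 4 ≤ 7 by norm_num)
      have t0 : 1 ≤ T ^ 7 := one_le_pow₀ hT
      linarith
    exact h2.trans (by have := hTpow 7; norm_num at this; linarith)
  have hLaLog0 : 0 ≤ Real.log La := Real.log_nonneg hLa1
  -- (Q2) `log B ≤ 188 u^70`
  have hBlog : Real.log B ≤ 188 * u ^ 70 := by
    have h1 : Real.log B ≤ Real.log La + (56 * T ^ 2 * Real.sqrt M + 27 * T ^ 4) := by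
      have := Real.log_le_log (by linarith) hB
      rwa [Real.log_mul (by positivity) (by positivity), Real.log_exp] at this
    have h2 : T ^ 2 * Real.sqrt M ≤ u ^ 70 := by
      rw [hsqrtM]
      calc T ^ 2 * u ^ 50 ≤ u ^ 20 * u ^ 50 :=
            mul_le_mul_of_nonneg_right (by have := hTpow 2; norm_num at this; exact this) (by positivity)
        _ = u ^ 70 := by ring
    have h3 : T ^ 4 ≤ u ^ 70 := (hTpow 4).trans (by norm_num; exact hupow (by norm_num))
    linarith
  -- (Q3) `P ≤ 188 u^70 / λ`
  have hP : P ≤ 188 * u ^ 70 / lam := by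
    rw [le_div_iff₀ hlam]; linarith
  -- (Q4) `S ≤ CS u^36`
  have hS0 : 0 < S := by linarith
  have hSCS : S ≤ CS * u ^ 36 := by
    rcases lt_or_ge S 16 with hS16 | hS16
    · calc S ≤ 16 := hS16.le
        _ ≤ CS * 1 := by linarith
        _ ≤ CS * u ^ 36 := mul_le_mul_of_nonneg_left (one_le_pow₀ hu1) hCS0
    · have hCh := hCheb hS16
      have hlogS0 : 0 < Real.log S := Real.log_pos (by linarith)
      have hlogS2 : Real.log S ^ 2 ≤ 4 * S := log_sq_le_four_mul (by linarith)
      have hP0 : 0 < P := lt_of_lt_of_le (by positivity) hCh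
      rw [div_le_iff₀ (by positivity)] at hCh
      -- `S ≤ 128 P`
      have hS128 : S ≤ 128 * P := by
        have h2 : P * (32 * Real.log S ^ 2) ≤ P * (32 * (4 * S)) :=
          mul_le_mul_of_nonneg_left (by linarith) hP0.le
        have h3 : S * S ≤ S * (128 * P) := by nlinarith [hCh, h2]
        exact le_of_mul_le_mul_left h3 hS0
      -- `log S ≤ (C₀ + 70) u`
      have hlogS : Real.log S ≤ (C₀ + 70) * u := by
        have h1 : S ≤ (128 * 188 / lam) * u ^ 70 := by
          calc S ≤ 128 * P := hS128
            _ ≤ 128 * (188 * u ^ 70 / lam) := by linarith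
            _ = (128 * 188 / lam) * u ^ 70 := by ring
        have h2 : Real.log S ≤ Real.log (128 * 188 / lam) + 70 * Real.log u := by
          have := Real.log_le_log hS0 h1
          rwa [Real.log_mul (by positivity) (by positivity), Real.log_pow] at this
        have h3 : Real.log (128 * 188 / lam) ≤ C₀ :=
          by rw [hC₀]; exact Real.log_le_log (by positivity) (le_max_right _ _)
        have h4 : Real.log u ≤ u := log_le_self_of_pos (by linarith)
        have h5 : C₀ ≤ C₀ * u := le_mul_of_one_le_right hC₀0 hu1
        linarith
      -- `S² ≤ 32 P log² S ≤ (32·188/λ) (C₀+70)² u^72`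
      have hS2 : S ^ 2 ≤ (Real.sqrt (32 * 188 / lam) * (C₀ + 70) * u ^ 36) ^ 2 := by
        have hlogS0' : 0 ≤ Real.log S := hlogS0.le
        calc S ^ 2 ≤ P * (32 * Real.log S ^ 2) := hCh
          _ ≤ (188 * u ^ 70 / lam) * (32 * ((C₀ + 70) * u) ^ 2) := by
              refine mul_le_mul hP ?_ (by positivity) (by positivity)
              have := pow_le_pow_left₀ hlogS0' hlogS 2
              linarith
          _ = (Real.sqrt (32 * 188 / lam) * (C₀ + 70) * u ^ 36) ^ 2 := by
              have hA := Real.sq_sqrt (show (0 : ℝ) ≤ 32 * 188 / lam by positivity)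
              rw [show (Real.sqrt (32 * 188 / lam) * (C₀ + 70) * u ^ 36) ^ 2 =
                Real.sqrt (32 * 188 / lam) ^ 2 * (C₀ + 70) ^ 2 * (u ^ 36) ^ 2 by ring, hA]
              field_simp
      have hS3 : S ≤ Real.sqrt (32 * 188 / lam) * (C₀ + 70) * u ^ 36 :=
        (pow_le_pow_iff_left₀ hS0.le (by positivity) two_ne_zero).mp hS2
      calc S ≤ Real.sqrt (32 * 188 / lam) * (C₀ + 70) * u ^ 36 := hS3
        _ ≤ CS * u ^ 36 :=
            mul_le_mul_of_nonneg_right (by rw [hCS]; exact le_max_right _ _) (by positivity)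
  -- (Q5) the main inequality in terms of `u`
  have hS1 : S + 1 ≤ 2 * S := by linarith
  have hsqrtS : Real.sqrt S ≤ Real.sqrt CS * u ^ 18 := by
    calc Real.sqrt S ≤ Real.sqrt (CS * u ^ 36) := Real.sqrt_le_sqrt hSCS
      _ = Real.sqrt CS * u ^ 18 := by
          rw [Real.sqrt_mul hCS0, show u ^ 36 = (u ^ 18) ^ 2 by ring, Real.sqrt_sq (by positivity)]
  have hLΦlog : Real.log (max 1 LΦ) ≤ 2 * (S + 1) + cΦ * S * Real.sqrt S := by
    have h1 : max 1 LΦ ≤ (S + 2) ^ 2 * Real.exp (cΦ * S * Real.sqrt S) := by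
      refine max_le ?_ hLΦ
      calc (1 : ℝ) = 1 * 1 := by ring
        _ ≤ (S + 2) ^ 2 * Real.exp (cΦ * S * Real.sqrt S) :=
            mul_le_mul (one_le_pow₀ (by linarith)) (Real.one_le_exp (by positivity)) zero_le_one
              (by positivity)
    have h2 := Real.log_le_log (lt_of_lt_of_le one_pos (le_max_left _ _)) h1
    rw [Real.log_mul (by positivity) (by positivity), Real.log_exp, Real.log_pow] at h2
    have h3 : Real.log (S + 2) ≤ S + 1 := by
      have := Real.log_le_sub_one_of_pos (show 0 < S + 2 by linarith); linarith
    push_cast at h2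
    linarith
  -- bound the bracket by `Ctot u^96`
  have hT6 : T ^ 6 ≤ u ^ 60 := by have := hTpow 6; norm_num at this; exact this
  have hT4 : T ^ 4 ≤ u ^ 40 := by have := hTpow 4; norm_num at this; exact this
  have hbr1 : S * (2 * T ^ 6 + T ^ 4) * cq ≤ 3 * cq * CS * u ^ 96 := by
    have h1 : 2 * T ^ 6 + T ^ 4 ≤ 3 * u ^ 60 := by
      have := hupow (show 40 ≤ 60 by norm_num); linarith
    calc S * (2 * T ^ 6 + T ^ 4) * cq ≤ (CS * u ^ 36) * (3 * u ^ 60) * cq := by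
          gcongr
      _ = 3 * cq * CS * u ^ 96 := by ring
  have hbr2 : T ^ 4 * (Real.log (max 1 LΦ) + (S + 1) * cJ) ≤
      (4 * CS + cΦ * CS * Real.sqrt CS + 2 * cJ * CS) * u ^ 96 := by
    have h1 : Real.log (max 1 LΦ) + (S + 1) * cJ ≤
        4 * CS * u ^ 36 + cΦ * (CS * u ^ 36) * (Real.sqrt CS * u ^ 18) + 2 * cJ * (CS * u ^ 36) := by
      have e1 : 2 * (S + 1) ≤ 4 * CS * u ^ 36 := by linarith
      have e2 : cΦ * S * Real.sqrt S ≤ cΦ * (CS * u ^ 36) * (Real.sqrt CS * u ^ 18) := by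
        gcongr
      have e3 : (S + 1) * cJ ≤ 2 * cJ * (CS * u ^ 36) := by
        have h : S + 1 ≤ 2 * (CS * u ^ 36) := by linarith
        calc (S + 1) * cJ ≤ (2 * (CS * u ^ 36)) * cJ := mul_le_mul_of_nonneg_right h hcJ
          _ = 2 * cJ * (CS * u ^ 36) := by ring
      linarith
    have h0 : 0 ≤ Real.log (max 1 LΦ) + (S + 1) * cJ :=
      add_nonneg (Real.log_nonneg (le_max_left _ _)) (by positivity)
    calc T ^ 4 * (Real.log (max 1 LΦ) + (S + 1) * cJ)
        ≤ u ^ 40 * (4 * CS * u ^ 36 + cΦ * (CS * u ^ 36) * (Real.sqrt CS * u ^ 18) +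
            2 * cJ * (CS * u ^ 36)) := mul_le_mul hT4 h1 h0 (by positivity)
      _ = 4 * CS * u ^ 76 + cΦ * CS * Real.sqrt CS * u ^ 94 + 2 * cJ * CS * u ^ 76 := by ring
      _ ≤ 4 * CS * u ^ 96 + cΦ * CS * Real.sqrt CS * u ^ 96 + 2 * cJ * CS * u ^ 96 := by
          have := hupow (show 76 ≤ 96 by norm_num)
          have := hupow (show 94 ≤ 96 by norm_num)
          gcongr
      _ = _ := by ring
  have hbracket : Real.log La + S * (2 * T ^ 6 + T ^ 4) * cq +
      T ^ 4 * (Real.log (max 1 LΦ) + (S + 1) * cJ) ≤ Ctot * u ^ 96 := by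
    have h70 : u ^ 70 ≤ u ^ 96 := hupow (show 70 ≤ 96 by norm_num)
    have hCtotexp : Ctot * u ^ 96 = 105 * u ^ 96 + 3 * cq * CS * u ^ 96 +
        (4 * CS + cΦ * CS * Real.sqrt CS + 2 * cJ * CS) * u ^ 96 := by
      rw [hCtot]; ring
    rw [hCtotexp]
    linarith
  -- from the main inequality: `λ u^100 ≤ 2 d₀ Ctot u^96`
  have hbracket0 : 0 ≤ Real.log La + S * (2 * T ^ 6 + T ^ 4) * cq +
      T ^ 4 * (Real.log (max 1 LΦ) + (S + 1) * cJ) := by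
    have : 0 ≤ Real.log (max 1 LΦ) := Real.log_nonneg (le_max_left _ _)
    positivity
  have hmain2 : M * lam ≤ 2 * d₀ * Ctot * u ^ 96 := by
    have h1 : S * M * lam ≤ d₀ * (2 * S) * (Ctot * u ^ 96) := by
      calc S * M * lam ≤ d₀ * (S + 1) * (Real.log La + S * (2 * T ^ 6 + T ^ 4) * cq +
            T ^ 4 * (Real.log (max 1 LΦ) + (S + 1) * cJ)) := hMain
        _ ≤ d₀ * (2 * S) * (Ctot * u ^ 96) :=
            mul_le_mul (mul_le_mul_of_nonneg_left hS1 hd₀) hbracket hbracket0 (by positivity)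
    have h2 : S * (M * lam) ≤ S * (2 * d₀ * Ctot * u ^ 96) := by linarith
    exact le_of_mul_le_mul_left h2 hS0
  have hu4 : u ^ 4 ≤ Cfin := by
    have h1 : u ^ 4 * (lam * u ^ 96) ≤ (2 * d₀ * Ctot / lam) * (lam * u ^ 96) := by
      rw [← hu100] at hmain2
      have : 2 * d₀ * Ctot / lam * (lam * u ^ 96) = 2 * d₀ * Ctot * u ^ 96 := by
        field_simp
      rw [this]
      calc u ^ 4 * (lam * u ^ 96) = u ^ 100 * lam := by ring
        _ ≤ 2 * d₀ * Ctot * u ^ 96 := hmain2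
    exact (le_of_mul_le_mul_right h1 (by positivity)).trans (by rw [hCfin]; exact le_max_right _ _)
  -- (Q6) `T ≤ u^10 ≤ (u^4)^3 ≤ Cfin^3`
  calc T ≤ u ^ 10 := hTu
    _ ≤ u ^ 12 := hupow (by norm_num)
    _ = (u ^ 4) ^ 3 := by ring
    _ ≤ Cfin ^ 3 := pow_le_pow_left₀ (by positivity) hu4 3

end Literature.NumberTheory.Transcendental

end
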